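import Literature.NumberTheory.Transcendental.BakerQuantSetup
import HarnessLib

/-!
# Cijsouw–Waldschmidt 1977 over `ℚ`: the `Δ`-polynomials (sizes, scaling, integrality)

Support file (theorems only) for the proof of Cijsouw–Waldschmidt 1977, Proposition 1 over `ℚ`
with `p = 2`. The `Δ`-part of the auxiliary function is Baker's triangular family
`w_{a,b} = Δ(X; a) Δ(X; h)ᵇ` of `BakerQuantDelta.lean` (`wPoly a b h`, `a ≤ h`), used at the
points `2^{J₀−J} s` of the finest lattice of the `2`-descent (so that all evaluation points are
natural numbers and Baker's integrality lemma `exists_nat_hasseDeriv_wPoly_eval` applies — in place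
of Cijsouw–Waldschmidt's Lemma 3 with the point-independent `ν(k) = lcm(1, …, k)`).

* `CW77.norm_hasseDeriv_wPoly_eval_le_exp` — a size bound LOGARITHMIC in `|z|`:
  `|((1/m!) dᵐ w_{a,b})(z)| ≤ 2^{a+bh} (e(⌈|z|⌉+h)/h)^{h(b+1)}` (the tree's
  `norm_hasseDeriv_wPoly_eval_le` is `4^{(⌈|z|⌉+h)(b+1)}`, linear in `|z|`, too weak at the
  points of the finest lattice); Cijsouw–Waldschmidt (8): `|Δ^{(t)}_{λ₀}(z)| ≤ exp(c₅ν^{2n+3}U)`.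
* `CW77.iterate_derivative_comp_C_mul_X`, `CW77.hasseDeriv_comp_C_mul_X_eval` — the chain rule for
  `w(c·X)`: `(1/m!) dᵐ (w(cX)) = cᵐ ((1/m!)dᵐ w)(cX)`.
* `CW77.exists_nat_hasseDeriv_wPoly_comp_eval` — at a natural number `s`, with `c ∈ ℕ`,
  `ν(cs, h)ᵐ · ((1/m!) dᵐ (w_{a,b}(cX)))(s)` is a natural number (Cijsouw–Waldschmidt (9)).

## References

* [CijsouwWaldschmidt1977] P. L. Cijsouw, M. Waldschmidt, *Linear forms and simultaneous
  approximations*, Compositio Math. 34 (1977), 173–197 — Lemma 3 (p. 181), (8)–(9) (p. 184).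
* [BakerTNT1975] A. Baker, *Transcendental Number Theory* (1975), Ch. 3 §2 Lemma 1.
-/

noncomputable section

open Finset Polynomial Real
open Literature.NumberTheory.Transcendental.Baker1975.Ch3

namespace Literature.NumberTheory.Transcendental.CW77

/-! ### A size bound logarithmic in `|z|` -/

/-- `binom(y+a, a) ≤ binom(y+h, h)` for `a ≤ h`. [folklore] -/
theorem choose_add_mono {a h : ℕ} (hah : a ≤ h) (y : ℕ) : (y + a).choose a ≤ (y + h).choose h := by
  have h1 : (y + a).choose a = (y + a).choose y := by
    rw [Nat.choose_symm_of_eq_add]; omega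
  have h2 : (y + h).choose h = (y + h).choose y := by
    rw [Nat.choose_symm_of_eq_add]; omega
  rw [h1, h2]
  exact Nat.choose_le_choose y (by omega)

/-- **Size of the Hasse derivatives of `w_{a,b}`, binomial form**: for `a ≤ h`,
`|((1/m!) dᵐ w_{a,b})(z)| ≤ 2^{a+bh} binom(⌈|z|⌉+h, h)^{b+1}`. [cite: BakerTNT1975, Ch. 3 §2 Lemma 1] -/
theorem norm_hasseDeriv_wPoly_eval_le_choose {a b h : ℕ} (hah : a ≤ h) (z : ℂ) (m : ℕ) :
    ‖(hasseDeriv m (wPoly a b h)).eval z‖ ≤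
      2 ^ (a + b * h) * (((⌈‖z‖⌉₊ + h).choose h : ℕ) : ℝ) ^ (b + 1) := by
  classical
  set y := ⌈‖z‖⌉₊ with hy
  have hw0 : (0 : ℝ) < wDen a b h := by exact_mod_cast wDen_pos a b h
  rw [hasseDeriv_wPoly, eval_mul, eval_C, norm_mul, norm_inv, Complex.norm_natCast]
  have h1 := norm_hasseDeriv_prod_X_add_C_eval_le (Finset.univ : Finset (Slot a b h))
    (fun i => slotVal i) (fun i _ => one_le_slotVal i) z m
  have h2 : ((2 ^ (Finset.univ : Finset (Slot a b h)).card *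
      ∏ i : Slot a b h, (⌈‖z‖⌉₊ + slotVal i) : ℕ) : ℝ) =
      (wDen a b h : ℝ) * ((2 ^ (a + b * h) * ((y + a).choose a * (y + h).choose h ^ b) : ℕ) : ℝ) := by
    rw [Finset.card_univ, card_Slot, prod_add_slotVal_eq]
    push_cast; ring
  unfold wNum at h1 ⊢
  rw [h2] at h1
  calc (wDen a b h : ℝ)⁻¹ * ‖(hasseDeriv m (∏ i, (X + C ((slotVal i : ℕ) : ℂ)))).eval z‖
      ≤ (wDen a b h : ℝ)⁻¹ * ((wDen a b h : ℝ) *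
          ((2 ^ (a + b * h) * ((y + a).choose a * (y + h).choose h ^ b) : ℕ) : ℝ)) :=
        mul_le_mul_of_nonneg_left h1 (by positivity)
    _ = ((2 ^ (a + b * h) * ((y + a).choose a * (y + h).choose h ^ b) : ℕ) : ℝ) := by
        rw [← mul_assoc, inv_mul_cancel₀ hw0.ne', one_mul]
    _ ≤ ((2 ^ (a + b * h) * ((y + h).choose h * (y + h).choose h ^ b) : ℕ) : ℝ) := by
        exact_mod_cast Nat.mul_le_mul_left _ (Nat.mul_le_mul_right _ (choose_add_mono hah y))
    _ = 2 ^ (a + b * h) * (((y + h).choose h : ℕ) : ℝ) ^ (b + 1) := by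
        push_cast; ring

/-- **Size of the Hasse derivatives of `w_{a,b}`, logarithmic in `|z|`**: for `1 ≤ a ≤ h`… no,
for `a ≤ h` and `h ≥ 1`, `|((1/m!) dᵐ w_{a,b})(z)| ≤ 2^{a+bh} (e(⌈|z|⌉+h)/h)^{h(b+1)}`
(Cijsouw–Waldschmidt (8): "`|Δ^{(t)}_{λ₀}(z)| ≤ exp(c₅ν^{2n+3}U)` for `|z| ≤ 6S`").
[cite: CijsouwWaldschmidt1977, (8) (p. 184)] [cite: BakerTNT1975, Ch. 3 §2 Lemma 1] -/
theorem norm_hasseDeriv_wPoly_eval_le_exp {a b h : ℕ} (hah : a ≤ h) (hh : 1 ≤ h) (z : ℂ) (m : ℕ) :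
    ‖(hasseDeriv m (wPoly a b h)).eval z‖ ≤
      2 ^ (a + b * h) * (Real.exp 1 * (⌈‖z‖⌉₊ + h) / h) ^ (h * (b + 1)) := by
  refine (norm_hasseDeriv_wPoly_eval_le_choose hah z m).trans ?_
  apply mul_le_mul_of_nonneg_left _ (by positivity)
  rw [pow_mul]
  apply pow_le_pow_left₀ (by positivity)
  exact choose_le_exp_mul_div_pow (x := ⌈‖z‖⌉₊) hh

/-! ### The chain rule for `w(c · X)` -/

/-- `d^[m] (w(cX)) = cᵐ · (d^[m] w)(cX)`. [folklore] -/
theorem iterate_derivative_comp_C_mul_X (w : ℂ[X]) (c : ℂ) (m : ℕ) :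
    derivative^[m] (w.comp (C c * X)) = C (c ^ m) * (derivative^[m] w).comp (C c * X) := by
  induction m with
  | zero => simp
  | succ m ih =>
    rw [Function.iterate_succ_apply', ih, derivative_mul, derivative_C, zero_mul, zero_add,
      derivative_comp, derivative_mul, derivative_C, zero_mul, zero_add, derivative_X, mul_one,
      Function.iterate_succ_apply', pow_succ, C_mul]
    ring

/-- `((1/m!) dᵐ (w(cX)))(z) = cᵐ · ((1/m!) dᵐ w)(cz)`. [folklore] -/
theorem hasseDeriv_comp_C_mul_X_eval (w : ℂ[X]) (c z : ℂ) (m : ℕ) :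
    (hasseDeriv m (w.comp (C c * X))).eval z = c ^ m * (hasseDeriv m w).eval (c * z) := by
  have hm : (m.factorial : ℂ) ≠ 0 := by exact_mod_cast (Nat.factorial_pos m).ne'
  have h1 := iterate_derivative_eval_eq_factorial_mul_hasseDeriv (w.comp (C c * X)) m z
  have h2 := iterate_derivative_eval_eq_factorial_mul_hasseDeriv w m (c * z)
  rw [iterate_derivative_comp_C_mul_X, eval_mul, eval_C, eval_comp, eval_mul, eval_C, eval_X, h2] at h1
  -- `h1 : c^m * (m! * H w (cz)) = m! * H (w∘) z`
  have : (m.factorial : ℂ) * (hasseDeriv m (w.comp (C c * X))).eval z =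
      (m.factorial : ℂ) * (c ^ m * (hasseDeriv m w).eval (c * z)) := by rw [← h1]; ring
  exact mul_left_cancel₀ hm this

/-- `(w(cX))(z) = w(cz)`. [folklore] -/
theorem eval_comp_C_mul_X (w : ℂ[X]) (c z : ℂ) : (w.comp (C c * X)).eval z = w.eval (c * z) := by
  rw [eval_comp, eval_mul, eval_C, eval_X]

/-! ### Integrality and size at the points of the finest lattice -/

/-- **Integrality at natural points of the scaled polynomial** (Cijsouw–Waldschmidt (9), via
Baker's Lemma 1): for `a ≤ h` and natural `c, s`, the number
`ν(cs, h)ᵐ · ((1/m!) dᵐ (w_{a,b}(cX)))(s)` is a natural number `E` with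
`E ≤ cᵐ 2^{a+bh} ν(cs,h)ᵐ binom(cs+a, a) binom(cs+h, h)ᵇ`. [cite: CijsouwWaldschmidt1977, (9) (p. 184)]
[cite: BakerTNT1975, Ch. 3 §2 Lemma 1] -/
theorem exists_nat_hasseDeriv_wPoly_comp_eval {a b h : ℕ} (hah : a ≤ h) (c s m : ℕ) :
    ∃ E : ℕ, ((nuBound (c * s) h : ℂ)) ^ m *
        (hasseDeriv m ((wPoly a b h).comp (C (c : ℂ) * X))).eval (s : ℂ) = (E : ℂ) ∧
      E ≤ c ^ m * (2 ^ (a + b * h) * nuBound (c * s) h ^ m *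
        ((c * s + a).choose a * (c * s + h).choose h ^ b)) := by
  obtain ⟨E, hE, hEle⟩ := exists_nat_hasseDeriv_wPoly_eval hah (c * s) m
  refine ⟨c ^ m * E, ?_, Nat.mul_le_mul_left _ hEle⟩
  rw [hasseDeriv_comp_C_mul_X_eval]
  push_cast
  rw [← hE]; push_cast; ring

/-- **Size of the Hasse derivatives of the scaled polynomial**: for `a ≤ h`, `1 ≤ h`, real `c ≥ 0`… here
natural `c`, `|((1/m!) dᵐ (w_{a,b}(cX)))(z)| ≤ cᵐ 2^{a+bh} (e(⌈c|z|⌉+h)/h)^{h(b+1)}`.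
[cite: CijsouwWaldschmidt1977, (8) (p. 184)] -/
theorem norm_hasseDeriv_wPoly_comp_eval_le {a b h : ℕ} (hah : a ≤ h) (hh : 1 ≤ h) (c : ℕ) (z : ℂ) (m : ℕ) :
    ‖(hasseDeriv m ((wPoly a b h).comp (C (c : ℂ) * X))).eval z‖ ≤
      (c : ℝ) ^ m * (2 ^ (a + b * h) * (Real.exp 1 * (⌈(c : ℝ) * ‖z‖⌉₊ + h) / h) ^ (h * (b + 1))) := by
  rw [hasseDeriv_comp_C_mul_X_eval, norm_mul, norm_pow, Complex.norm_natCast]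
  apply mul_le_mul_of_nonneg_left _ (by positivity)
  have h1 := norm_hasseDeriv_wPoly_eval_le_exp (b := b) hah hh ((c : ℂ) * z) m
  have hcz : ‖(c : ℂ) * z‖ = (c : ℝ) * ‖z‖ := by rw [norm_mul, Complex.norm_natCast]
  rwa [hcz] at h1

end Literature.NumberTheory.Transcendental.CW77
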